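import Summits.HodgeConjecture.HodgeConjecture.Theses.KuznetsovCYFactory
import Literature.AlgebraicGeometry.HodgeTheory.HypersurfaceLefschetzUpper

/-!
# Route KuznetsovCYFactory — `HypersurfaceOffMiddleHC` (support item stmt-HodgeConjecture-1884)

The Hodge conjecture off the middle degree for smooth hypersurfaces `X ⊂ ℙⁿ⁺¹_ℂ`: for `2p ≠ n` every
rational `(p, p)`-class of `H²ᵖ(X(ℂ); ℂ)` is algebraic — indeed `algebraicClasses X p = ⊤`: for
`0 < p < n` by Lefschetz's theorem on hyperplane sections (the tree's discharged named fact
`Voisin2003_smoothHypersurface_algebraicClasses_eq_top_holds`), for `p = 0` and `p ≥ n` by the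
elementary `algebraicClasses_eq_top_of_eq_zero_or_le`.  No named-fact hypothesis, no sorry.
-/

-- `Summit.HodgeConjecture.HodgeConjecture.Theorems` is the mandated namespace (single-problem
-- summit: Problem = Summit), which `linter.dupNamespace` flags on every declaration; the lakefile
-- turns the linter off tree-wide (weak option), restated here so stand-alone elaboration is
-- warning-free too.
set_option linter.dupNamespace false

namespace Summit.HodgeConjecture.HodgeConjecture.Theorems

open Literature.AlgebraicGeometry.Motives Literature.AlgebraicGeometry.HodgeTheory

/-- **Item stmt-HodgeConjecture-1884 (`HypersurfaceOffMiddleHC`), route `KuznetsovCYFactory`**: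
for a smooth hypersurface of dimension `n` and `2p ≠ n`, `algebraicClasses X p = ⊤` (Lefschetz for
`0 < p < n`, elementary for `p = 0` and `p ≥ n`), so every rational `(p, p)`-class is algebraic.
[cite: VoisinHodgeII2003, Thm. 1.23, Cor. 1.24 and Cor. 1.25] [cite: VoisinHodgeI2002, §11.1.2 and §11.3] -/
theorem kuznetsovCYFactory_hypersurfaceOffMiddleHC_proof :
    Summit.HodgeConjecture.HodgeConjecture.Theses.KuznetsovCYFactory.HypersurfaceOffMiddleHC := by
  intro n d X hY p hp c _hc _hpp
  by_cases h : 0 < p ∧ p < n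
  · rw [Voisin2003_smoothHypersurface_algebraicClasses_eq_top_holds hY p h.1 h.2 hp]
    exact Submodule.mem_top
  · rw [algebraicClasses_eq_top_of_eq_zero_or_le hY.1 (by omega)]
    exact Submodule.mem_top

end Summit.HodgeConjecture.HodgeConjecture.Theorems
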